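import Summits.BirchSwinnertonDyer.Rank1Residual.X9.LeafDischargeKolyvaginSah
import Summits.BirchSwinnertonDyer.Rank1Residual.X10.LeafDischargeX10b
import Summits.BirchSwinnertonDyer.BirchSwinnertonDyer.Theorems.ClassRecordThreeShimuraKolyvaginImageOverK
import HarnessLib

/-!
# Class X10b: the DISCHARGE INTERFACE for the Kolyvagin/Čebotarev image inputs on Heegner frames
# at `p = 3` (the X10b twins of files F, G, H of the X9 interface)

Print-tier cell `bsd-print-x9` (D-0131 (2), key `x9`), typer seat ty2, file I of the discharge
interface (X10b side; files F = `X9/LeafDischargeKolyvaginCebotarev`, G = `…Sah`, H = `…H61` are the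
X9 side, B = `X10/LeafDischargeX10b` the X10b cyclotomic side). Theorems only: no definition, no
new named fact (D-0014 / D-0026); nothing here is a class theorem; X10b keeps its label.

A Heegner road at `p = 3` for the X10b leaf (`ClassX10 W 3 ∧ ¬ Surj W 3`: `p = 3` good ordinary,
`E[3]` irreducible, mod-3 image not onto) is banked in the tree (p4's
`X10b.bsdp_rankOne_of_heegnerDivisibilityAt_of_mazurMainConjectureOnClassX10b`,
`Theorems/PrintX10bHeegnerRoad.lean`), with Jetchev's divisibility at `3` as its J-input. Every
IMAGE input of the Kolyvagin machinery that input needs is a kernel theorem on X10b Heegner frames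
(`K` imaginary quadratic, Heegner hypothesis for `N_E`, `3` split in `K`), read here on the class
predicate exactly as files F–H do on X9 — all through the bsd-potss lane's
`JetchevIrreducibleCebotarev.*` (any odd `p`, (Z) = any scalar `≢ 1`) and, for the sign form at `3`,
the bsd-stepL lane's `ShimuraKolyvaginImageOverK` (every irreducible subgroup of `GL₂(𝔽₃)`
realises `−1` as a square):

* `ClassX10.kolyvaginImage_full_of_heegner` — `ρ̄_{E,3}(Γ_K) = ρ̄_{E,3}(Γ_ℚ)` (Gross's disjointness;
  Matar–Nekovář Prop. 5.26 (1));
* `ClassX10.kolyvaginImage_simple_of_heegner` = `ClassX10.irr_baseChange_of_heegner` ((S) = (irr_K),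
  a KERNEL replacement of file B's by-name `ClassX10.irr_three_baseChange_of_mn526` on split frames),
  `…_scalarCommutant_of_heegner` (C), `…_scalar_of_heegner` / `…_scalar_unit_of_heegner` /
  `…_scalar_pow_of_heegner` (Z, at level `3` and `3^M`);
* `ClassX10.torsionBy_baseChange_pow_eq_bot'` — `E(K)[3^M] = 0` for every quadratic `K`;
* `ClassX10.cor32_pow_of_heegner` — McCallum Cor. 3.2 at level `3^M`, printed form, UNCONDITIONAL
  (Zhang's currency is file F's `ClassX10.cor32_localOrder_of_heegner`);
* `ClassX10.exists_homothety_noFixedVector_baseChange_of_heegner` /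
  `ClassX10.exists_homothety_pow_noFixedVector_of_heegner` — the Sah shapes ((C4) at `3`, `3^M`);
* (the `h61`-currency twin `ClassX10.exists_kolyvaginPrime_addOrderOf_localization_eq_of_heegner`
  lives in file H = `X9/LeafDischargeKolyvaginH61`, next to its X9 sibling);
* `ClassX10.exists_smul_eq_neg_baseChange` / `…_pow` — the sign form `−1 ∈ ρ_{E,3^M}(Γ_K)` for EVERY
  quadratic `K` (no Heegner hypothesis), from the stepL lane.

## References

* [McCallumLMS1991] §3 Cor. 3.2 (pp. 298–299), §4 (5). [Jetchev2008] Lemma 5.1 (p. 821), Rem. 6.2.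
* [GrossLMS1991] §9 (PDF p. 227), Prop. 9.1, Prop. 9.3, Lemma 4.3.
* [MatarNekovar2019] Prop. 5.26 (1)–(3) (p. 492), Prop. 6.4 (C4), Prop. 6.5, Cor. 5.21 (e′).
* [Cha2005] Thm. 7 (p. 158), Lemmas 22–23. [Sah1968] Prop. 2.7 (b). [Serre1972] §2.4–§2.6, §5.4.
-/

set_option autoImplicit false

noncomputable section

open scoped Classical

universe u

open WeierstrassCurve IsDedekindDomain NumberField Field Literature.NumberTheory.EllipticCurves
  Literature.NumberTheory.GaloisRepresentations
  Summit.BirchSwinnertonDyer.BirchSwinnertonDyer.Theorems.JetchevIrreducibleCebotarev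

namespace Literature.NumberTheory.EllipticCurves.Rank1Residual

section X10b

variable {W : WeierstrassCurve ℚ} [W.IsElliptic] [W.IsGloballyMinimal] {p : ℕ} [Fact p.Prime]

/-! ### 1. The image inputs over `K` -/

/-- **(image) on X10b Heegner frames**: every `γ ∈ Γ_ℚ` acts on `E[3]` as some `g ∈ Γ_K` (`K`
imaginary quadratic, Heegner hypothesis for `N_E`, `3` split in `K`).
[cite: GrossLMS1991, §9 (PDF p. 227, before Prop. 9.1)] [cite: MatarNekovar2019, Prop. 5.26 (1)] -/
theorem ClassX10.kolyvaginImage_full_of_heegner (_h : ClassX10 W p) {K : Type u} [Field K]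
    [NumberField K] (hK : IsImaginaryQuadratic K)
    (hHN : SatisfiesHeegnerHypothesis (W.conductorNorm ℤ) K) (hHp : SatisfiesHeegnerHypothesis p K) :
    ∀ γ : absoluteGaloisGroup ℚ, ∃ g : absoluteGaloisGroup K,
      ∀ P : geomTorsion W p, absGaloisRestrict ℚ K g • P = γ • P :=
  forall_exists_absGaloisRestrict_smul_eq_of_heegner W hK hHN hHp

/-- **(S) on X10b Heegner frames: `E(K̄)[3]` is a simple `Γ_K`-module.**
[cite: GrossLMS1991, Prop. 9.3 (proof)] [cite: MatarNekovar2019, Prop. 5.26 (2)] -/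
theorem ClassX10.kolyvaginImage_simple_of_heegner (h : ClassX10 W p) {K : Type u} [Field K]
    [NumberField K] (hK : IsImaginaryQuadratic K)
    (hHN : SatisfiesHeegnerHypothesis (W.conductorNorm ℤ) K) (hHp : SatisfiesHeegnerHypothesis p K) :
    ∀ H : AddSubgroup (geomTorsion (W.baseChange K) p),
      (∀ g : absoluteGaloisGroup K, ∀ t ∈ H, g • t ∈ H) → H = ⊥ ∨ H = ⊤ :=
  simple_baseChange_of_irreducible W h.irr (h.kolyvaginImage_full_of_heegner hK hHN hHp)

/-- **(irr_K) on X10b Heegner frames, IN THE KERNEL** (`(W⁄K).HasIrreducibleModPGaloisRep 3`):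
flag-free replacement of file B's by-name `ClassX10.irr_three_baseChange_of_mn526` (MN19 Prop.
5.26 (2)) whenever `3` is split in `K`. [cite: MatarNekovar2019, Prop. 5.26 (2) (p. 492)] -/
theorem ClassX10.irr_baseChange_of_heegner (h : ClassX10 W p) {K : Type u} [Field K]
    [NumberField K] (hK : IsImaginaryQuadratic K)
    (hHN : SatisfiesHeegnerHypothesis (W.conductorNorm ℤ) K) (hHp : SatisfiesHeegnerHypothesis p K) :
    (W.baseChange K).HasIrreducibleModPGaloisRep p :=
  h.kolyvaginImage_simple_of_heegner hK hHN hHp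

/-- **(C) on X10b Heegner frames: the `Γ_K`-commutant of `E(K̄)[3]` is scalar** (kernel replacement
of MN19 Prop. 5.26 (3) by name). [cite: GrossLMS1991, Prop. 9.3 (proof)]
[cite: MatarNekovar2019, Prop. 5.26 (3)] -/
theorem ClassX10.kolyvaginImage_scalarCommutant_of_heegner (h : ClassX10 W p) {K : Type u}
    [Field K] [NumberField K] (hK : IsImaginaryQuadratic K)
    (hHN : SatisfiesHeegnerHypothesis (W.conductorNorm ℤ) K) (hHp : SatisfiesHeegnerHypothesis p K) :
    ∀ f : geomTorsion (W.baseChange K) p →+ geomTorsion (W.baseChange K) p,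
      (∀ (g : absoluteGaloisGroup K) (t : geomTorsion (W.baseChange K) p), f (g • t) = g • f t) →
        ∃ k : ℤ, ∀ t, f t = k • t :=
  exists_eq_zsmul_baseChange_of_irreducible W h.ne_two h.irr
    (h.kolyvaginImage_full_of_heegner hK hHN hHp)

/-- **(Z) on X10b Heegner frames**: some `z ∈ Γ_K` acts on `E(K̄)[3]` as a scalar `a ≢ 1 (mod 3)`.
[cite: Serre1972, §2.6] [cite: MatarNekovar2019, Prop. 5.15] -/
theorem ClassX10.kolyvaginImage_scalar_of_heegner (h : ClassX10 W p) {K : Type u} [Field K]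
    [NumberField K] (hK : IsImaginaryQuadratic K)
    (hHN : SatisfiesHeegnerHypothesis (W.conductorNorm ℤ) K) (hHp : SatisfiesHeegnerHypothesis p K) :
    ∃ (z : absoluteGaloisGroup K) (a : ℤ), ¬ (p : ℤ) ∣ a - 1 ∧
      ∀ P : geomTorsion (W.baseChange K) p, z • P = a • P :=
  exists_smul_eq_smul_baseChange_of_irreducible W h.ne_two h.irr
    (h.kolyvaginImage_full_of_heegner hK hHN hHp)

/-- **(Z) on X10b Heegner frames with the scalar a unit mod `3`** (same argument as the X9
`ClassX9.kolyvaginImage_scalar_unit_of_heegner`: `z` is an automorphism of `E[3] ≠ 0`).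
[cite: Serre1972, §2.6] [cite: Sah1968, Prop. 2.7 (b)] -/
theorem ClassX10.kolyvaginImage_scalar_unit_of_heegner (h : ClassX10 W p) {K : Type u} [Field K]
    [NumberField K] (hK : IsImaginaryQuadratic K)
    (hHN : SatisfiesHeegnerHypothesis (W.conductorNorm ℤ) K) (hHp : SatisfiesHeegnerHypothesis p K) :
    ∃ (z : absoluteGaloisGroup K) (a : ℤ), ¬ (p : ℤ) ∣ a ∧ ¬ (p : ℤ) ∣ a - 1 ∧
      ∀ P : geomTorsion (W.baseChange K) p, z • P = a • P := by
  have hp : p.Prime := Fact.out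
  obtain ⟨z, a, ha1, hz⟩ := h.kolyvaginImage_scalar_of_heegner hK hHN hHp
  refine ⟨z, a, ?_, ha1, hz⟩
  rintro ⟨c, hc⟩
  have hkill : ∀ P : geomTorsion (W.baseChange K) p, (p : ℤ) • P = 0 := fun P ↦ Subtype.ext (by
    rw [AddSubgroupClass.coe_zsmul, ZeroMemClass.coe_zero]
    exact (mem_geomTorsion_iff (W.baseChange K) _ _).mp P.2)
  have hall : ∀ P : geomTorsion (W.baseChange K) p, P = 0 := fun P ↦ by
    have h1 : z • P = 0 := by rw [hz, hc, mul_comm, mul_smul, hkill, smul_zero]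
    calc P = z⁻¹ • z • P := (inv_smul_smul z P).symm
      _ = 0 := by rw [h1, smul_zero]
  haveI : Subsingleton (geomTorsion (W.baseChange K) p) := ⟨fun P Q ↦ by rw [hall P, hall Q]⟩
  have hcard : Nat.card (geomTorsion (W.baseChange K) p) = p ^ 2 :=
    card_torsionPoints_eq_sq_holds (W.baseChange K) (AlgebraicClosure K) (n := p)
      (by exact_mod_cast hp.ne_zero)
  rw [Nat.card_of_subsingleton (0 : geomTorsion (W.baseChange K) p)] at hcard
  have h1lt : 1 < p ^ 2 := Nat.one_lt_pow two_ne_zero hp.one_lt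
  omega

/-- **(C4) at level `3^M` on X10b Heegner frames**: `z^{3^{M−1}}` acts on `E(K̄)[3^M]` as
`a^{3^{M−1}} ≢ 0, 1 (mod 3)`. [cite: Cha2005, Thm. 7 (p. 158)]
[cite: MatarNekovar2019, Prop. 6.4 (C4), Prop. 6.5 (p. 498)] -/
theorem ClassX10.kolyvaginImage_scalar_pow_of_heegner (h : ClassX10 W p) {K : Type u} [Field K]
    [NumberField K] (hK : IsImaginaryQuadratic K)
    (hHN : SatisfiesHeegnerHypothesis (W.conductorNorm ℤ) K) (hHp : SatisfiesHeegnerHypothesis p K)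
    {M : ℕ} (hM : 1 ≤ M) :
    ∃ (z : absoluteGaloisGroup K) (a : ℤ), ¬ (p : ℤ) ∣ a ∧ ¬ (p : ℤ) ∣ a - 1 ∧
      ∀ P : geomTorsion (W.baseChange K) ((p ^ M : ℕ) : ℤ), z • P = a • P := by
  have hp : p.Prime := Fact.out
  obtain ⟨z, a, ha0, ha1, hz⟩ := h.kolyvaginImage_scalar_unit_of_heegner hK hHN hHp
  have h2 := prime_dvd_pow_prime_pow_sub hp a (M - 1)
  refine ⟨z ^ p ^ (M - 1), a ^ p ^ (M - 1), fun hd ↦ ha0 ?_, fun hd ↦ ha1 ?_, fun P ↦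
    smul_pow_eq_smul_geomTorsion_pow (W.baseChange K) hp hM ha0 hz P⟩
  · have : a = a ^ p ^ (M - 1) - (a ^ p ^ (M - 1) - a) := by ring
    rw [this]
    exact dvd_sub hd h2
  · have : a - 1 = (a ^ p ^ (M - 1) - 1) - (a ^ p ^ (M - 1) - a) := by ring
    rw [this]
    exact dvd_sub hd h2

/-- **`E(K)[3^M] = 0` on class X10b, for every quadratic field `K`** (from (irr) at `3`, `3` odd).
[cite: GrossLMS1991, Lemma 4.3 (p. 242)] [cite: McCallumLMS1991, §4 (5)] -/
theorem ClassX10.torsionBy_baseChange_pow_eq_bot' (h : ClassX10 W p) (K : Type u) [Field K]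
    [NumberField K] (hK : Module.finrank ℚ K = 2) (M : ℕ) :
    AddSubgroup.torsionBy (W.baseChange K).toAffine.Point ((p ^ M : ℕ) : ℤ) = ⊥ :=
  torsionBy_pow_eq_bot
    (torsionBy_eq_bot_of_hasIrreducibleModPGaloisRep W K hK (Fact.out : p.Prime) h.irr) M

/-! ### 2. McCallum Cor. 3.2 (printed form), the Sah shapes, `h61` -/

/-- **McCallum 1991 Cor. 3.2 at level `3^M` on X10b Heegner frames, printed form, UNCONDITIONAL**
(a Kolyvagin prime above every bound, `IsKolyvaginPrime N W K 3 ℓ`, `Frob(ℓ) = Frob(∞)` in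
`Gal(K(E_{3^M})/ℚ)`, `ord c_{i,λ} = 3^{N_i}` exactly). Zhang's currency: file F's
`ClassX10.cor32_localOrder_of_heegner`. [cite: McCallumLMS1991, §3 Cor. 3.2 (with Prop. 3.1)]
[cite: Jetchev2008, Lemma 5.1, Rem. 6.2] -/
theorem ClassX10.cor32_pow_of_heegner (h : ClassX10 W p) {N : ℕ} [NeZero N] {K : Type u} [Field K]
    [NumberField K] (hK : IsImaginaryQuadratic K)
    (hHN : SatisfiesHeegnerHypothesis (W.conductorNorm ℤ) K) (hHp : SatisfiesHeegnerHypothesis p K)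
    {M : ℕ} (hM : 1 ≤ M) {c : K ≃ₐ[ℚ] K} (hc : c ≠ 1) {r : ℕ}
    (cs : Fin r → galH1Torsion (W.baseChange K) ((p ^ M : ℕ) : ℤ)) (h0 : ∀ i, cs i ≠ 0)
    (Nv : Fin r → ℕ) (hN : ∀ i, Nv i ≠ 0 → ((p : ℤ) ^ (Nv i - 1)) • cs i ≠ 0)
    (hτ : ∀ i, ∃ e : ℤ, (e = 1 ∨ e = -1) ∧ conjAct W c ((p ^ M : ℕ) : ℤ) (cs i) = e • cs i)
    (hind : ∀ a : Fin r → ℤ, ∑ i, a i • cs i = 0 → ∀ i, a i • cs i = 0) (b : ℕ) :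
    ∃ ℓ : ℕ, b < ℓ ∧ IsKolyvaginPrime N W K p ℓ ∧ FrobEqFrobInfty W K (p ^ M) ℓ ∧
      ∀ i, ∀ v : HeightOneSpectrum (𝓞 K), (ℓ : 𝓞 K) ∈ v.asIdeal →
        (((p : ℤ) ^ Nv i) • cs i ∈
            (W.baseChange K).torsionLocalKer (v.adicCompletion K) ((p ^ M : ℕ) : ℤ) ∧
          (Nv i ≠ 0 → ((p : ℤ) ^ (Nv i - 1)) • cs i ∉
            (W.baseChange K).torsionLocalKer (v.adicCompletion K) ((p ^ M : ℕ) : ℤ))) := by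
  obtain ⟨z, a, ha1, hz⟩ := h.kolyvaginImage_scalar_of_heegner hK hHN hHp
  exact cor32_pow_of_image (W := W) (K := K) (N := N)
    Literature.NumberTheory.Automorphic.chebotarev_artinRep_holds hK Fact.out h.ne_two
    (h.kolyvaginImage_simple_of_heegner hK hHN hHp) (h.kolyvaginImage_scalarCommutant_of_heegner hK hHN hHp)
    ha1 hz (W.exists_weilPairing_holds p) hM hc cs h0 Nv hN hτ hind b

/-- **The Sah shape at level `3` over `K`, on X10b Heegner frames** (`hz` of the tree's
`galoisCohomology.res_one_injective_of_forall_fixed_eq_zero` for `(W⁄K).torsionGaloisModule 3`).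
[cite: GrossLMS1991, Prop. 9.1] [cite: Sah1968, Prop. 2.7 (b)] -/
theorem ClassX10.exists_homothety_noFixedVector_baseChange_of_heegner (h : ClassX10 W p) {K : Type u}
    [Field K] [NumberField K] (hK : IsImaginaryQuadratic K)
    (hHN : SatisfiesHeegnerHypothesis (W.conductorNorm ℤ) K) (hHp : SatisfiesHeegnerHypothesis p K) :
    ∃ (z : absoluteGaloisGroup K) (a : ℤ),
      (∀ m : geomTorsion (W.baseChange K) (p : ℤ),
        (W.baseChange K).torsionGaloisModule (p : ℤ) z m = a • m) ∧
      (∀ m : geomTorsion (W.baseChange K) (p : ℤ),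
        (W.baseChange K).torsionGaloisModule (p : ℤ) z m = m → m = 0) := by
  have hp : p.Prime := Fact.out
  obtain ⟨z, a, ha1, hz⟩ := h.kolyvaginImage_scalar_of_heegner hK hHN hHp
  refine ⟨z, a, fun m ↦ by rw [WeierstrassCurve.torsionGaloisModule_apply_apply, hz m],
    fun m hm ↦ ?_⟩
  rw [WeierstrassCurve.torsionGaloisModule_apply_apply, hz m] at hm
  exact eq_zero_of_smul_eq_of_prime hp (AddSubgroup.torsionBy.nsmul m) ha1 hm

/-- **The Sah shape at level `3^M` over `K`, on X10b Heegner frames** (`M ≥ 1`): the input of Sah's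
lemma for `H¹(K(E[3^M])/K, E[3^M]) = 0` (Cha 2005 Thm. 7; Matar–Nekovář (C4)).
[cite: Cha2005, Thm. 7 (p. 158)] [cite: MatarNekovar2019, Prop. 6.4 (C4), Prop. 6.5 (p. 498)]
[cite: Sah1968, Prop. 2.7 (b)] -/
theorem ClassX10.exists_homothety_pow_noFixedVector_of_heegner (h : ClassX10 W p) {K : Type u}
    [Field K] [NumberField K] (hK : IsImaginaryQuadratic K)
    (hHN : SatisfiesHeegnerHypothesis (W.conductorNorm ℤ) K) (hHp : SatisfiesHeegnerHypothesis p K)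
    {M : ℕ} (hM : 1 ≤ M) :
    ∃ (z : absoluteGaloisGroup K) (a : ℤ),
      (∀ m : geomTorsion (W.baseChange K) ((p ^ M : ℕ) : ℤ),
        (W.baseChange K).torsionGaloisModule ((p ^ M : ℕ) : ℤ) z m = a • m) ∧
      (∀ m : geomTorsion (W.baseChange K) ((p ^ M : ℕ) : ℤ),
        (W.baseChange K).torsionGaloisModule ((p ^ M : ℕ) : ℤ) z m = m → m = 0) := by
  have hp : p.Prime := Fact.out
  obtain ⟨z, a, -, ha1, hz⟩ := h.kolyvaginImage_scalar_pow_of_heegner hK hHN hHp hM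
  refine ⟨z, a, fun m ↦ by rw [WeierstrassCurve.torsionGaloisModule_apply_apply, hz m],
    fun m hm ↦ ?_⟩
  rw [WeierstrassCurve.torsionGaloisModule_apply_apply, hz m] at hm
  exact eq_zero_of_smul_eq_of_prime_pow hp M (AddSubgroup.torsionBy.nsmul m) ha1 hm

/-! ### 3. The sign form at `3`: `−1 ∈ ρ_{E,3^M}(Γ_K)` for EVERY quadratic `K` -/

/-- **`−1 ∈ ρ̄_{E,3}(Γ_K)` on class X10b for EVERY quadratic field `K`** (no Heegner hypothesis):
every irreducible subgroup of `GL₂(𝔽₃)` realises `−1` as a square, and squares of `Γ_ℚ` restrict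
from `Γ_K` (bsd-stepL lane, `ShimuraKolyvaginImageOverK.exists_smul_eq_neg_three_of_irr_of_finrank_eq_two`).
The `hz = −1` input of the tree's `KolyvaginPairing` lemmas in the sign form.
[cite: GrossLMS1991, §9 Prop. 9.1] [cite: MatarNekovar2019, Cor. 5.21 (e′) and Prop. 5.26 (2)] -/
theorem ClassX10.exists_smul_eq_neg_baseChange (h : ClassX10 W p) (K : Type u) [Field K]
    [NumberField K] (hK : Module.finrank ℚ K = 2) :
    ∃ z : absoluteGaloisGroup K, ∀ Q : geomTorsion (W.baseChange K) (p : ℤ), z • Q = -Q := by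
  obtain ⟨rfl, -, hirr, -⟩ := h
  exact Summit.BirchSwinnertonDyer.BirchSwinnertonDyer.Theorems.ShimuraKolyvaginImageOverK.exists_smul_eq_neg_three_of_irr_of_finrank_eq_two
    W K hK hirr

/-- **`−1 ∈ ρ_{E,3^M}(Γ_K)` on class X10b for EVERY quadratic field `K`**, every `M ≥ 1` (the
level-`3` element raised to the power `3^{M−1}`).
[cite: McCallumLMS1991, §3 (standing hypothesis, used on E_p only)] -/
theorem ClassX10.exists_smul_eq_neg_baseChange_pow (h : ClassX10 W p) (K : Type u) [Field K]
    [NumberField K] (hK : Module.finrank ℚ K = 2) {M : ℕ} (hM : 1 ≤ M) :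
    ∃ z : absoluteGaloisGroup K,
      ∀ Q : geomTorsion (W.baseChange K) ((p ^ M : ℕ) : ℤ), z • Q = -Q := by
  obtain ⟨z, hz⟩ := h.exists_smul_eq_neg_baseChange K hK
  have hodd : Odd p := (Fact.out : p.Prime).odd_of_ne_two h.ne_two
  exact ⟨z ^ p ^ (M - 1), fun Q ↦ smul_eq_neg_geomTorsion_pow (W.baseChange K) hodd hM hz Q⟩

end X10b

end Literature.NumberTheory.EllipticCurves.Rank1Residual

end
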